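import Summits.QuantumFields.YangMills.Theorems.ColdStartUniversalityUniformColdStartMixingRungOfErgodic
import HarnessLib

/-!
# Route `ColdStartUniversality`, crux K_A1 `UniformColdStartMixing` (stmt-QuantumFields-24809), rung
# `stub_fixedCutoffMixing`: input (E) split — lattice-time ergodicity UNIFORM over all cold-start solutions
# ⇐ (E1) uniqueness in law of the one-time marginals + (E3) Cesàro ergodicity along SOME cold-start solution

Helper file (seat `ym-line-csu-p1`).  The single open input (E) `hyp_latticeErgodic` of the rung
(`fixedCutoffMixing_of_latticeErgodic'`, `…UniformColdStartMixingRungOfErgodic`) asks for a lattice mixing time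
valid for EVERY cold-start solution on EVERY filtered probability space.  It splits into two inputs of different
nature:

* (E1) **uniqueness in law** (one-time marginals): any two cold-start solutions of the SU(2) SZZ dynamics on
  `(ℤ/L)³` at coupling `β'`, on any two probability spaces (in `Type`) with flat Brownian drivers, have the same
  law at each lattice time `t` — the Yamada–Watanabe consequence of PATHWISE UNIQUENESS (landed:
  `latticeLangevin_pathwise_unique`, `latticeLangevinWellPosed_su2`) plus weak existence; what remains for (E1)
  is the transport «solution = measurable functional of the driver» and the uniqueness of the law of a flat
  Brownian motion;
* (E3) **Cesàro ergodicity along some cold-start solution**: for bounded measurable `f` and `δ > 0` a lattice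
  time `T₀` such that for every `T ≥ T₀` SOME cold-start solution has `|∫ f dμ_{β'} − T⁻¹∫₀ᵀ E f(U_t) dt| ≤ δ`
  (the analytic core: Markov property, invariance of the Wilson measure = SZZ Lemma 3.3, irreducibility of the
  elliptic diffusion on the compact connected `SU(2)^E`).

`latticeErgodic_of_lawUnique` proves (E) from (E1) ∧ (E3) (change of variables `integral_map`: the Cesàro
integrand `E_P f(U_t) = ∫ f d(law U_t)` depends on the solution only through its one-time laws), and
`fixedCutoffMixing_of_lawUnique` the rung from (E1) ∧ (E3).  No definition, no sorry.  RECORD-rung R3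
plumbing; NOT K_A1, not the mass gap. -/

set_option autoImplicit false

noncomputable section

namespace Summit.QuantumFields.YangMills.Theorems.ColdStartUniversality

open MeasureTheory ProbabilityTheory intervalIntegral
open scoped NNReal
open Literature.MathematicalPhysics.QuantumFieldTheory
open Literature.MathematicalPhysics.QuantumLattice (fundamentalRep fundamentalLatticeRep)
open Literature.MathematicalPhysics.QuantumFieldTheory.Balaban1983to89

/-- **(E) from (E1) and (E3).**  If (E1) all cold-start solutions of the SU(2) SZZ dynamics have the same
one-time laws and (E3) for every bounded measurable observable some cold-start solution is Cesàro-ergodic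
beyond a lattice time `T₀` (for each `T ≥ T₀`), then every cold-start solution on every space is, with the same
`T₀` — the rung's input (E) `hyp_latticeErgodic` verbatim. [folklore] -/
theorem latticeErgodic_of_lawUnique
    (hLaw : ∀ (L : ℕ) [NeZero L] (β' : ℝ)
      (Ω : Type) (mΩ : MeasurableSpace Ω) (P : Measure Ω) (hP : IsProbabilityMeasure P)
      (W : ℝ≥0 → Ω → (Edge 3 L × NoiseIdx 2 → ℝ)) (hW : IsFlatBrownian W P)
      (U : ℝ≥0 → Ω → GaugeConfig 3 L (Matrix.specialUnitaryGroup (Fin 2) ℂ))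
      (Ω' : Type) (mΩ' : MeasurableSpace Ω') (P' : Measure Ω') (hP' : IsProbabilityMeasure P')
      (W' : ℝ≥0 → Ω' → (Edge 3 L × NoiseIdx 2 → ℝ)) (hW' : IsFlatBrownian W' P')
      (U' : ℝ≥0 → Ω' → GaugeConfig 3 L (Matrix.specialUnitaryGroup (Fin 2) ℂ)),
      (∀ ω, U 0 ω = fun _ => 1) →
      (latticeLangevinDynamics (fundamentalLatticeRep 2) β').IsSolution (fundamentalRep (Fin 2))
        hW.natFiltration P W U →
      (∀ ω, U' 0 ω = fun _ => 1) →
      (latticeLangevinDynamics (fundamentalLatticeRep 2) β').IsSolution (fundamentalRep (Fin 2))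
        hW'.natFiltration P' W' U' →
      ∀ t : ℝ≥0, Measure.map (U t) P = Measure.map (U' t) P')
    (hSome : ∀ (L : ℕ) [NeZero L] (β' : ℝ)
      (f : GaugeConfig 3 L (Matrix.specialUnitaryGroup (Fin 2) ℂ) → ℝ), Measurable f → (∀ V, |f V| ≤ 1) →
      ∀ δ : ℝ, 0 < δ → ∃ T₀ : ℝ, 0 < T₀ ∧ ∀ T : ℝ, T₀ ≤ T →
        ∃ (Ω : Type) (_mΩ : MeasurableSpace Ω) (P : Measure Ω) (_hP : IsProbabilityMeasure P)
          (W : ℝ≥0 → Ω → (Edge 3 L × NoiseIdx 2 → ℝ)) (hW : IsFlatBrownian W P)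
          (U : ℝ≥0 → Ω → GaugeConfig 3 L (Matrix.specialUnitaryGroup (Fin 2) ℂ)),
          (∀ ω, U 0 ω = fun _ => 1) ∧
          (latticeLangevinDynamics (fundamentalLatticeRep 2) β').IsSolution (fundamentalRep (Fin 2))
            hW.natFiltration P W U ∧
          |(∫ V, f V ∂(wilsonMeasure (d := 3) (L := L) (fundamentalRep (Fin 2)) β')) -
              T⁻¹ * ∫ t in (0 : ℝ)..T, (∫ ω, f (U t.toNNReal ω) ∂P)| ≤ δ) :
    ∀ (L : ℕ) [NeZero L] (β' : ℝ)
      (f : GaugeConfig 3 L (Matrix.specialUnitaryGroup (Fin 2) ℂ) → ℝ), Measurable f → (∀ V, |f V| ≤ 1) →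
      ∀ δ : ℝ, 0 < δ → ∃ T₀ : ℝ, 0 < T₀ ∧ ∀ T : ℝ, T₀ ≤ T →
        ∀ (Ω : Type) (mΩ : MeasurableSpace Ω) (P : Measure Ω) (hP : IsProbabilityMeasure P)
          (W : ℝ≥0 → Ω → (Edge 3 L × NoiseIdx 2 → ℝ)) (hW : IsFlatBrownian W P)
          (U : ℝ≥0 → Ω → GaugeConfig 3 L (Matrix.specialUnitaryGroup (Fin 2) ℂ)),
          (∀ ω, U 0 ω = fun _ => 1) →
          (latticeLangevinDynamics (fundamentalLatticeRep 2) β').IsSolution (fundamentalRep (Fin 2))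
            hW.natFiltration P W U →
          |(∫ V, f V ∂(wilsonMeasure (d := 3) (L := L) (fundamentalRep (Fin 2)) β')) -
              T⁻¹ * ∫ t in (0 : ℝ)..T, (∫ ω, f (U t.toNNReal ω) ∂P)| ≤ δ := by
  intro L _ β' f hfm hfb δ hδ
  obtain ⟨T₀, hT₀, hT⟩ := hSome L β' f hfm hfb δ hδ
  refine ⟨T₀, hT₀, fun T hTT Ω mΩ P hP W hW U hU0 hsol => ?_⟩
  obtain ⟨Ω', mΩ', P', hP', W', hW', U', hU'0, hsol', hbound⟩ := hT T hTT
  -- the Cesàro integrands agree: `E_P f(U_t) = ∫ f d(law U_t) = ∫ f d(law U'_t) = E_P' f(U'_t)`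
  have hint : ∀ t : ℝ, (∫ ω, f (U t.toNNReal ω) ∂P) = ∫ ω, f (U' t.toNNReal ω) ∂P' := by
    intro t
    have hmU : Measurable (U t.toNNReal) := (hsol.adapted _).mono (hW.natFiltration.le _) le_rfl
    have hmU' : Measurable (U' t.toNNReal) := (hsol'.adapted _).mono (hW'.natFiltration.le _) le_rfl
    rw [← integral_map hmU.aemeasurable hfm.aestronglyMeasurable,
      ← integral_map hmU'.aemeasurable hfm.aestronglyMeasurable,
      hLaw L β' Ω mΩ P hP W hW U Ω' mΩ' P' hP' W' hW' U' hU0 hsol hU'0 hsol' t.toNNReal]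
  simp_rw [hint]
  exact hbound

/-- **The rung `stub_fixedCutoffMixing` from (E1) uniqueness in law and (E3) Cesàro ergodicity along some
cold-start solution** (the Gibbs dictionary (D) and observable regularity (R) being discharged in the tree):
for every `F`, `γ > 0`, `os`, `δ > 0`, `K` there is a physical time `T > 0` with
`|expectAt K os − T⁻¹ ∫₀ᵀ E[∏ avgObs (U(s/ε_K))] ds| ≤ δ` for every cold-start strong solution at
`β' = (γ ε_K)⁻¹/2`. [folklore] -/
theorem fixedCutoffMixing_of_lawUnique
    (hLaw : ∀ (L : ℕ) [NeZero L] (β' : ℝ)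
      (Ω : Type) (mΩ : MeasurableSpace Ω) (P : Measure Ω) (hP : IsProbabilityMeasure P)
      (W : ℝ≥0 → Ω → (Edge 3 L × NoiseIdx 2 → ℝ)) (hW : IsFlatBrownian W P)
      (U : ℝ≥0 → Ω → GaugeConfig 3 L (Matrix.specialUnitaryGroup (Fin 2) ℂ))
      (Ω' : Type) (mΩ' : MeasurableSpace Ω') (P' : Measure Ω') (hP' : IsProbabilityMeasure P')
      (W' : ℝ≥0 → Ω' → (Edge 3 L × NoiseIdx 2 → ℝ)) (hW' : IsFlatBrownian W' P')
      (U' : ℝ≥0 → Ω' → GaugeConfig 3 L (Matrix.specialUnitaryGroup (Fin 2) ℂ)),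
      (∀ ω, U 0 ω = fun _ => 1) →
      (latticeLangevinDynamics (fundamentalLatticeRep 2) β').IsSolution (fundamentalRep (Fin 2))
        hW.natFiltration P W U →
      (∀ ω, U' 0 ω = fun _ => 1) →
      (latticeLangevinDynamics (fundamentalLatticeRep 2) β').IsSolution (fundamentalRep (Fin 2))
        hW'.natFiltration P' W' U' →
      ∀ t : ℝ≥0, Measure.map (U t) P = Measure.map (U' t) P')
    (hSome : ∀ (L : ℕ) [NeZero L] (β' : ℝ)
      (f : GaugeConfig 3 L (Matrix.specialUnitaryGroup (Fin 2) ℂ) → ℝ), Measurable f → (∀ V, |f V| ≤ 1) →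
      ∀ δ : ℝ, 0 < δ → ∃ T₀ : ℝ, 0 < T₀ ∧ ∀ T : ℝ, T₀ ≤ T →
        ∃ (Ω : Type) (_mΩ : MeasurableSpace Ω) (P : Measure Ω) (_hP : IsProbabilityMeasure P)
          (W : ℝ≥0 → Ω → (Edge 3 L × NoiseIdx 2 → ℝ)) (hW : IsFlatBrownian W P)
          (U : ℝ≥0 → Ω → GaugeConfig 3 L (Matrix.specialUnitaryGroup (Fin 2) ℂ)),
          (∀ ω, U 0 ω = fun _ => 1) ∧
          (latticeLangevinDynamics (fundamentalLatticeRep 2) β').IsSolution (fundamentalRep (Fin 2))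
            hW.natFiltration P W U ∧
          |(∫ V, f V ∂(wilsonMeasure (d := 3) (L := L) (fundamentalRep (Fin 2)) β')) -
              T⁻¹ * ∫ t in (0 : ℝ)..T, (∫ ω, f (U t.toNNReal ω) ∂P)| ≤ δ) :
    ∀ (F : T3ContinuumYM3Torus.T3Family) (γ : ℝ), 0 < γ →
      ∀ (os : List (T3ContinuumYM3Torus.ULoop3 F)) (δ : ℝ), 0 < δ → ∀ K : ℕ, ∃ T : ℝ, 0 < T ∧
        ∀ (Ω : Type) (mΩ : MeasurableSpace Ω) (P : Measure Ω) (hP : IsProbabilityMeasure P)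
          (W : ℝ≥0 → Ω → (Edge 3 ((F.P K).sitesPerDir 0) × NoiseIdx 2 → ℝ)) (hW : IsFlatBrownian W P)
          (U : ℝ≥0 → Ω → GaugeConfig 3 ((F.P K).sitesPerDir 0) (Matrix.specialUnitaryGroup (Fin 2) ℂ)),
          (∀ ω, U 0 ω = fun _ => 1) →
          (latticeLangevinDynamics (fundamentalLatticeRep 2) ((γ * (F.P K).eps)⁻¹ / 2)).IsSolution
            (fundamentalRep (Fin 2)) hW.natFiltration P W U →
          |(F.scheme (ExpMeanLog.expMeanLogSU : LoopAverage (Matrix.specialUnitaryGroup (Fin 2) ℂ)) γ).expectAt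
                K os -
              T⁻¹ * ∫ s in (0 : ℝ)..T, (∫ ω, (os.map fun C => F.avgObs (ExpMeanLog.expMeanLogSU :
                  LoopAverage (Matrix.specialUnitaryGroup (Fin 2) ℂ)) K C
                (fun b : PBond (F.P K) 0 => U (s / (F.P K).eps).toNNReal ω (b.src, b.dir))).prod ∂P)| ≤ δ :=
  fixedCutoffMixing_of_latticeErgodic' (latticeErgodic_of_lawUnique hLaw hSome)

end Summit.QuantumFields.YangMills.Theorems.ColdStartUniversality

end
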